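import Summits.KontsevichZagierPeriods.KontsevichZagierPeriods.Theorems.FurushoPentagonDoubleShuffleInKZDissectionAlgebra
import Summits.KontsevichZagierPeriods.KontsevichZagierPeriods.Theorems.FurushoPentagonDoubleShuffleInKZRiderDissectionAux

/-!
# `DoubleShuffleInKZ` (stmt-KontsevichZagierPeriods-14665, route `FurushoPentagon`): the rider dissection

Helper file (`--supports stmt-KontsevichZagierPeriods-14665`), line "rider lever" for the
Kaneko–Yamamoto integral–series family `IS_j(u)`.  THE MIXED REPRESENTATIONS of the line: for an
admissible index `w'` (weight `n'`, cubical integrand `f_{w'}`), a block `m'` (first slot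
`q' = p_{m'}`) and `j` RIDERS, the representation `C_j(w', m')` has domain

  `{(v, x) ∈ ℝʲ × ℝⁿ' | x ∈ (0,1)ⁿ', 0 < v₀ < v₁ < ⋯ < v_{j-1} < 1, v_{j-1} < x_{q'}}`

(riders first, increasing, the top rider adjacent to and below the cubical coordinate `x_{q'}`) and
integrand `f_{w'}(x) · ∏_a 1/(1 − v_a)` — the cubical word integrand with an unfolded chain
`Li_{1,…,1}` hanging below `x_{q'}`.

THE DISSECTION (`rider_dissection`).  For `w` admissible (weight `n`, depth `k`), a block `m < k`
and `j + 1` riders, the END representation of the rider lever,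
`[{x ∈ (0,1)ⁿ, 0 < v₀ < ⋯ < v_j < 1}, (f_w(x) − v_j f_w(x|_{q := v_j x_q})) · ∏_{a ≤ j} 1/(1 − v_a)]`,
EXISTS and is congruent modulo `KZ.relations` to
`Σ_{m ≤ i < k} (C_j(raise_i w, i) + C_j(ins_i w, i+1))` for every family `C_j` pinned to the mixed
representations with `j` riders: by `stuffle_integrand_eq_from` the integrand splits EXACTLY into the
integrands of those representations read along a coordinate permutation (the top rider `v_j` moved
into block `i` / placed as the new block after block `i`; the other riders stay passive), so this is
iterated integrand additivity (`KZ.of_sub_of_sub_sum_mem_relations`) followed by one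
`KZ.of_sub_of_reindex_mem_relations` per summand — the stuffle side of the `HoffmanRelationInKZ` line
(`stub_stuffleDissection`) with riders and from a block on.

References: M. Kontsevich, D. Zagier, *Periods* (2001), §1.2; K. Ihara, M. Kaneko, D. Zagier,
Compos. Math. 142 (2006), Thm 2; M. Kaneko, S. Yamamoto, Selecta Math. 24 (2018), Thm 4.1.
-/

noncomputable section

open Set MeasureTheory Finset
open Literature.NumberTheory.Transcendental
open Summit.KontsevichZagierPeriods.FurushoPentagon.HoffmanRelationInKZ

namespace Summit.KontsevichZagierPeriods.FurushoPentagon.DoubleShuffleInKZ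

/-! ### The dissection -/

/-- **The rider dissection** (stuffle side of the `HoffmanRelationInKZ` line, with `j` passive riders
and from block `m` on).  For a non-empty admissible `w` (weight `n`, depth `k`), a block `m < k`
(first slot `q = p_m`, dilation `σ_c x = x|_{q := c x_q}`) and a family `C` pinned to the mixed
representations with `j` riders: the END representation
`[{x ∈ (0,1)ⁿ, 0 < v₀ < ⋯ < v_j < 1}, (f_w(x) − v_j f_w(σ_{v_j} x)) · ∏_{a ≤ j} 1/(1 − v_a)]` exists, and
every representation of that shape is congruent modulo `KZ.relations` to
`Σ_{m ≤ i < k} (C(raise_i w, i) + C(ins_i w, i + 1))` — the integrand splits exactly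
(`stuffle_integrand_eq_from`) into the integrands of the pinned representations read along the
coordinate permutations moving `v_j` into block `i` / after block `i` (`piece_domain_eq`,
`HoffmanRelationInKZ.cubical_raise_at_perm`, `…cubical_insertOne_at_perm`): iterated integrand
additivity and one reindexing move per summand. [cite: KontsevichZagier2001, §1.2] -/
theorem rider_dissection (w : List ℕ) (hw : MZV.IsAdmissible w) (hne : w ≠ []) {m : ℕ}
    (hm : m < w.length) (j : ℕ)
    (F : (Fin (MZV.weight w) → ℝ) → ℝ) (σ : ℝ → (Fin (MZV.weight w) → ℝ) → (Fin (MZV.weight w) → ℝ))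
    (hF : ∀ x, F x = ∏ l : Fin w.length, (∏ t : Fin (MZV.weight w),
      if (t : ℕ) < (w.take l).sum then x t else 1) / (1 - (∏ t : Fin (MZV.weight w),
      if (t : ℕ) < (w.take ((l : ℕ) + 1)).sum then x t else 1)))
    (hσ : ∀ (c : ℝ) (x : Fin (MZV.weight w) → ℝ) (t : Fin (MZV.weight w)),
      σ c x t = if (t : ℕ) = (w.take m).sum then c * x t else x t)
    (C : List ℕ → ℕ → KZ.FormalRep)
    (hC : ∀ (w' : List ℕ), MZV.IsAdmissible w' → w' ≠ [] → ∀ (m' : ℕ), m' < w'.length →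
      ∃ r : KZ.IntegralRep (j + MZV.weight w'),
        r.domain = {z : Fin (j + MZV.weight w') → ℝ |
          (∀ i : Fin (MZV.weight w'), z (Fin.natAdd j i) ∈ Set.Ioo (0:ℝ) 1) ∧
          (∀ a : Fin j, z (Fin.castAdd (MZV.weight w') a) ∈ Set.Ioo (0:ℝ) 1) ∧
          (∀ a b : Fin j, a < b → z (Fin.castAdd (MZV.weight w') a) < z (Fin.castAdd (MZV.weight w') b)) ∧
          (∀ a : Fin j, (a : ℕ) + 1 = j → ∀ i : Fin (MZV.weight w'), (i : ℕ) = (w'.take m').sum →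
            z (Fin.castAdd (MZV.weight w') a) < z (Fin.natAdd j i))} ∧
        Set.EqOn r.integrand (fun z => (∏ l : Fin w'.length,
          (∏ t : Fin (MZV.weight w'), if (t : ℕ) < (w'.take l).sum then z (Fin.natAdd j t) else 1) /
          (1 - (∏ t : Fin (MZV.weight w'),
            if (t : ℕ) < (w'.take ((l : ℕ) + 1)).sum then z (Fin.natAdd j t) else 1))) *
          ∏ a : Fin j, 1 / (1 - z (Fin.castAdd (MZV.weight w') a))) r.domain ∧
        C w' m' = KZ.of r) :
    (∃ r : KZ.IntegralRep ((j + 1) + MZV.weight w),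
      r.domain = {z : Fin ((j + 1) + MZV.weight w) → ℝ |
        (∀ i : Fin (MZV.weight w), z (Fin.natAdd (j + 1) i) ∈ Set.Ioo (0:ℝ) 1) ∧
        (∀ a : Fin (j + 1), z (Fin.castAdd (MZV.weight w) a) ∈ Set.Ioo (0:ℝ) 1) ∧
        (∀ a b : Fin (j + 1), a < b → z (Fin.castAdd (MZV.weight w) a) < z (Fin.castAdd (MZV.weight w) b))} ∧
      Set.EqOn r.integrand (fun z => (F (fun t => z (Fin.natAdd (j + 1) t)) -
        z (Fin.castAdd (MZV.weight w) (Fin.last j)) *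
          F (σ (z (Fin.castAdd (MZV.weight w) (Fin.last j))) (fun t => z (Fin.natAdd (j + 1) t)))) *
        ∏ a : Fin (j + 1), 1 / (1 - z (Fin.castAdd (MZV.weight w) a))) r.domain) ∧
    ∀ r : KZ.IntegralRep ((j + 1) + MZV.weight w),
      r.domain = {z : Fin ((j + 1) + MZV.weight w) → ℝ |
        (∀ i : Fin (MZV.weight w), z (Fin.natAdd (j + 1) i) ∈ Set.Ioo (0:ℝ) 1) ∧
        (∀ a : Fin (j + 1), z (Fin.castAdd (MZV.weight w) a) ∈ Set.Ioo (0:ℝ) 1) ∧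
        (∀ a b : Fin (j + 1), a < b → z (Fin.castAdd (MZV.weight w) a) < z (Fin.castAdd (MZV.weight w) b))} →
      Set.EqOn r.integrand (fun z => (F (fun t => z (Fin.natAdd (j + 1) t)) -
        z (Fin.castAdd (MZV.weight w) (Fin.last j)) *
          F (σ (z (Fin.castAdd (MZV.weight w) (Fin.last j))) (fun t => z (Fin.natAdd (j + 1) t)))) *
        ∏ a : Fin (j + 1), 1 / (1 - z (Fin.castAdd (MZV.weight w) a))) r.domain →
      KZ.of r - ∑ i ∈ Finset.Ico m w.length,
        (C (w.take i ++ [w.getD i 0 + 1] ++ w.drop (i + 1)) i +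
          C (w.take (i + 1) ++ [1] ++ w.drop (i + 1)) (i + 1)) ∈ KZ.relations := by
  choose ρ hρd hρi hρC using hC
  have hjn : j + (MZV.weight w + 1) = (j + 1) + MZV.weight w := by omega
  -- block index of the `i`-th piece
  have hblk : ∀ i : Fin (w.length - m), m + (i : ℕ) < w.length := fun i => by have := i.2; omega
  -- the raised indices
  have hadm_r : ∀ i : Fin (w.length - m), MZV.IsAdmissible
      (w.take (m + i) ++ [w.getD (m + i) 0 + 1] ++ w.drop (m + i + 1)) :=
    fun i => Summit.KontsevichZagierPeriods.HoffmanRelationInKZ.Negative.isAdmissible_raise hw (hblk i)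
  have hne_r : ∀ i : Fin (w.length - m), w.take (m + i) ++ [w.getD (m + i) 0 + 1] ++ w.drop (m + i + 1) ≠ [] :=
    fun i => by simp
  have hw_r : ∀ i : Fin (w.length - m),
      MZV.weight (w.take (m + i) ++ [w.getD (m + i) 0 + 1] ++ w.drop (m + i + 1)) = MZV.weight w + 1 :=
    fun i => sum_raise' w _ (hblk i)
  have hlen_r : ∀ i : Fin (w.length - m),
      (w.take (m + i) ++ [w.getD (m + i) 0 + 1] ++ w.drop (m + i + 1)).length = w.length :=
    fun i => length_raise' w _ (hblk i)
  -- the inserted indices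
  have hadm_h : ∀ i : Fin (w.length - m), MZV.IsAdmissible (w.take (m + i + 1) ++ [1] ++ w.drop (m + i + 1)) := by
    intro i
    obtain ⟨b, t, rfl⟩ := List.exists_cons_of_ne_nil hne
    refine ⟨fun x hx => ?_, fun _ => ?_⟩
    · simp only [List.mem_append, List.mem_singleton] at hx
      rcases hx with (hx | rfl) | hx
      · exact hw.1 x (List.mem_of_mem_take hx)
      · exact le_rfl
      · exact hw.1 x (List.mem_of_mem_drop hx)
    · simpa using hw.2 (List.cons_ne_nil b t)
  have hne_h : ∀ i : Fin (w.length - m), w.take (m + i + 1) ++ [1] ++ w.drop (m + i + 1) ≠ [] := fun i => by simp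
  have hw_h : ∀ i : Fin (w.length - m), MZV.weight (w.take (m + i + 1) ++ [1] ++ w.drop (m + i + 1)) = MZV.weight w + 1 :=
    fun i => sum_insertOne w _ (hblk i)
  have hlen_h : ∀ i : Fin (w.length - m),
      (w.take (m + i + 1) ++ [1] ++ w.drop (m + i + 1)).length = w.length + 1 :=
    fun i => length_insertOne w _ (hblk i)
  -- the slots
  let Pr : Fin (w.length - m) → Fin (MZV.weight w + 1) :=
    fun i => ⟨(w.take (m + i)).sum, Nat.lt_succ_of_le (sum_take_le_sum w (m + i))⟩
  let Ph : Fin (w.length - m) → Fin (MZV.weight w + 1) :=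
    fun i => ⟨(w.take (m + i + 1)).sum, Nat.lt_succ_of_le (sum_take_le_sum w (m + i + 1))⟩
  -- the equivalences: keep the first `j` riders, move the top rider into slot `P`
  let Er : ∀ i : Fin (w.length - m), Fin (j + MZV.weight (w.take (m + i) ++ [w.getD (m + i) 0 + 1] ++
      w.drop (m + i + 1))) ≃ Fin ((j + 1) + MZV.weight w) :=
    fun i => ((finCongr (congrArg (j + ·) (hw_r i))).trans
      ((finSumFinEquiv.symm.trans ((Equiv.sumCongr (Equiv.refl (Fin j))
        (Pr i).cycleRange).trans finSumFinEquiv)))).trans (finCongr hjn)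
  let Eh : ∀ i : Fin (w.length - m), Fin (j + MZV.weight (w.take (m + i + 1) ++ [1] ++ w.drop (m + i + 1))) ≃
      Fin ((j + 1) + MZV.weight w) :=
    fun i => ((finCongr (congrArg (j + ·) (hw_h i))).trans
      ((finSumFinEquiv.symm.trans ((Equiv.sumCongr (Equiv.refl (Fin j))
        (Ph i).cycleRange).trans finSumFinEquiv)))).trans (finCongr hjn)
  have hEr1 : ∀ (i : Fin (w.length - m)) (a : Fin j), Er i (Fin.castAdd _ a) = Fin.castAdd (MZV.weight w) (Fin.castSucc a) := by
    intro i a; ext; simp [Er]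
  have hEh1 : ∀ (i : Fin (w.length - m)) (a : Fin j), Eh i (Fin.castAdd _ a) = Fin.castAdd (MZV.weight w) (Fin.castSucc a) := by
    intro i a; ext; simp [Eh]
  have hEr2 : ∀ (i : Fin (w.length - m)) (t : Fin (MZV.weight (w.take (m + i) ++ [w.getD (m + i) 0 + 1] ++
      w.drop (m + i + 1)))),
      Er i (Fin.natAdd j t) = Fin.cast hjn (Fin.natAdd j ((Pr i).cycleRange (Fin.cast (hw_r i) t))) := by
    intro i t
    have hc : (Fin.cast (congrArg (j + ·) (hw_r i)) (Fin.natAdd j t) : Fin (j + (MZV.weight w + 1))) =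
        Fin.natAdd j (Fin.cast (hw_r i) t) := by ext; simp
    ext; simp [Er, hc]
  have hEh2 : ∀ (i : Fin (w.length - m)) (t : Fin (MZV.weight (w.take (m + i + 1) ++ [1] ++ w.drop (m + i + 1)))),
      Eh i (Fin.natAdd j t) = Fin.cast hjn (Fin.natAdd j ((Ph i).cycleRange (Fin.cast (hw_h i) t))) := by
    intro i t
    have hc : (Fin.cast (congrArg (j + ·) (hw_h i)) (Fin.natAdd j t) : Fin (j + (MZV.weight w + 1))) =
        Fin.natAdd j (Fin.cast (hw_h i) t) := by ext; simp
    ext; simp [Eh, hc]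
  -- the pieces: coordinate permutations of the pinned representations
  let Rr : Fin (w.length - m) → KZ.IntegralRep ((j + 1) + MZV.weight w) :=
    fun i => (ρ _ (hadm_r i) (hne_r i) (m + i) (by rw [hlen_r]; exact hblk i)).reindex (Er i)
  let Rh : Fin (w.length - m) → KZ.IntegralRep ((j + 1) + MZV.weight w) :=
    fun i => (ρ _ (hadm_h i) (hne_h i) (m + i + 1) (by rw [hlen_h]; have := hblk i; omega)).reindex (Eh i)
  have hRr_dom : ∀ i, (Rr i).domain = {z : Fin ((j + 1) + MZV.weight w) → ℝ |
      (∀ i : Fin (MZV.weight w), z (Fin.natAdd (j + 1) i) ∈ Set.Ioo (0:ℝ) 1) ∧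
      (∀ a : Fin (j + 1), z (Fin.castAdd (MZV.weight w) a) ∈ Set.Ioo (0:ℝ) 1) ∧
      (∀ a b : Fin (j + 1), a < b → z (Fin.castAdd (MZV.weight w) a) < z (Fin.castAdd (MZV.weight w) b))} := by
    intro i
    show {z : Fin ((j + 1) + MZV.weight w) → ℝ | (fun idx => z (Er i idx)) ∈ (ρ _ (hadm_r i) (hne_r i) (m + i) _).domain} = _
    rw [hρd]
    exact piece_domain_eq _ (m + i) (hw_r i) (Pr i)
      (by rw [sum_take_raise' w _ _ (hblk i), if_pos le_rfl]) hjn (Er i) (hEr1 i) (hEr2 i)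
  have hRh_dom : ∀ i, (Rh i).domain = {z : Fin ((j + 1) + MZV.weight w) → ℝ |
      (∀ i : Fin (MZV.weight w), z (Fin.natAdd (j + 1) i) ∈ Set.Ioo (0:ℝ) 1) ∧
      (∀ a : Fin (j + 1), z (Fin.castAdd (MZV.weight w) a) ∈ Set.Ioo (0:ℝ) 1) ∧
      (∀ a b : Fin (j + 1), a < b → z (Fin.castAdd (MZV.weight w) a) < z (Fin.castAdd (MZV.weight w) b))} := by
    intro i
    show {z : Fin ((j + 1) + MZV.weight w) → ℝ | (fun idx => z (Eh i idx)) ∈ (ρ _ (hadm_h i) (hne_h i) (m + i + 1) _).domain} = _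
    rw [hρd]
    exact piece_domain_eq _ (m + i + 1) (hw_h i) (Ph i)
      (by rw [sum_take_insertOne w _ _ (hblk i), if_pos le_rfl]) hjn (Eh i) (hEh1 i) (hEh2 i)
  -- the block `(v_j, x)` of a point `z`
  have h0 : (Fin.cast hjn (Fin.natAdd j (0 : Fin (MZV.weight w + 1))) : Fin ((j + 1) + MZV.weight w)) =
      Fin.castAdd (MZV.weight w) (Fin.last j) := by ext; simp
  have hs : ∀ t : Fin (MZV.weight w), (Fin.cast hjn (Fin.natAdd j t.succ) : Fin ((j + 1) + MZV.weight w)) =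
      Fin.natAdd (j + 1) t := by intro t; ext; simp; omega
  -- the integrands of the pieces
  have hRr_int : ∀ (i : Fin (w.length - m)) (z : Fin ((j + 1) + MZV.weight w) → ℝ), z ∈ (Rr i).domain →
      (Rr i).integrand z = (∏ l ∈ range w.length,
        (if l ≤ m + i then (∏ t : Fin (MZV.weight w), if (t : ℕ) < (w.take l).sum then
            (fun s : Fin (MZV.weight w + 1) => z (Fin.cast hjn (Fin.natAdd j s))) t.succ else 1)
          else (fun s : Fin (MZV.weight w + 1) => z (Fin.cast hjn (Fin.natAdd j s))) 0 *
            ∏ t : Fin (MZV.weight w), if (t : ℕ) < (w.take l).sum then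
              (fun s : Fin (MZV.weight w + 1) => z (Fin.cast hjn (Fin.natAdd j s))) t.succ else 1) /
        (1 - (if l + 1 ≤ m + i
          then (∏ t : Fin (MZV.weight w), if (t : ℕ) < (w.take (l + 1)).sum then
            (fun s : Fin (MZV.weight w + 1) => z (Fin.cast hjn (Fin.natAdd j s))) t.succ else 1)
          else (fun s : Fin (MZV.weight w + 1) => z (Fin.cast hjn (Fin.natAdd j s))) 0 *
            ∏ t : Fin (MZV.weight w), if (t : ℕ) < (w.take (l + 1)).sum then
              (fun s : Fin (MZV.weight w + 1) => z (Fin.cast hjn (Fin.natAdd j s))) t.succ else 1))) *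
        ∏ a : Fin j, 1 / (1 - z (Fin.castAdd (MZV.weight w) (Fin.castSucc a))) := by
    intro i z hz
    have hmem : (fun idx => z (Er i idx)) ∈ (ρ _ (hadm_r i) (hne_r i) (m + i) _).domain := hz
    show (ρ _ (hadm_r i) (hne_r i) (m + i) _).integrand (fun idx => z (Er i idx)) = _
    rw [hρi _ _ _ _ _ hmem]
    simp only [hEr1, hEr2]
    congr 1
    exact cubical_raise_at_perm w _ (hlen_r i) (fun r => sum_take_raise' w _ r (hblk i))
      (fun s : Fin (MZV.weight w + 1) => z (Fin.cast hjn (Fin.natAdd j s))) (Pr i) rfl (hw_r i)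
      ((finCongr (hw_r i)).trans (Pr i).cycleRange) (fun t => rfl)
  have hRh_int : ∀ (i : Fin (w.length - m)) (z : Fin ((j + 1) + MZV.weight w) → ℝ), z ∈ (Rh i).domain →
      (Rh i).integrand z = (∏ l ∈ range (w.length + 1),
        (if l ≤ m + i + 1 then (∏ t : Fin (MZV.weight w), if (t : ℕ) < (w.take l).sum then
            (fun s : Fin (MZV.weight w + 1) => z (Fin.cast hjn (Fin.natAdd j s))) t.succ else 1)
          else (fun s : Fin (MZV.weight w + 1) => z (Fin.cast hjn (Fin.natAdd j s))) 0 *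
            ∏ t : Fin (MZV.weight w), if (t : ℕ) < (w.take (l - 1)).sum then
              (fun s : Fin (MZV.weight w + 1) => z (Fin.cast hjn (Fin.natAdd j s))) t.succ else 1) /
        (1 - (if l ≤ m + i
          then (∏ t : Fin (MZV.weight w), if (t : ℕ) < (w.take (l + 1)).sum then
            (fun s : Fin (MZV.weight w + 1) => z (Fin.cast hjn (Fin.natAdd j s))) t.succ else 1)
          else (fun s : Fin (MZV.weight w + 1) => z (Fin.cast hjn (Fin.natAdd j s))) 0 *
            ∏ t : Fin (MZV.weight w), if (t : ℕ) < (w.take l).sum then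
              (fun s : Fin (MZV.weight w + 1) => z (Fin.cast hjn (Fin.natAdd j s))) t.succ else 1))) *
        ∏ a : Fin j, 1 / (1 - z (Fin.castAdd (MZV.weight w) (Fin.castSucc a))) := by
    intro i z hz
    have hmem : (fun idx => z (Eh i idx)) ∈ (ρ _ (hadm_h i) (hne_h i) (m + i + 1) _).domain := hz
    show (ρ _ (hadm_h i) (hne_h i) (m + i + 1) _).integrand (fun idx => z (Eh i idx)) = _
    rw [hρi _ _ _ _ _ hmem]
    simp only [hEh1, hEh2]
    congr 1
    exact cubical_insertOne_at_perm w _ (hlen_h i) (fun r => sum_take_insertOne w _ r (hblk i))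
      (fun s : Fin (MZV.weight w + 1) => z (Fin.cast hjn (Fin.natAdd j s))) (Ph i) rfl (hw_h i)
      ((finCongr (hw_h i)).trans (Ph i).cycleRange) (fun t => rfl)
  -- the dissection of the END integrand on the END domain
  have hsplit : ∀ z : Fin ((j + 1) + MZV.weight w) → ℝ, z ∈ {z : Fin ((j + 1) + MZV.weight w) → ℝ |
        (∀ i : Fin (MZV.weight w), z (Fin.natAdd (j + 1) i) ∈ Set.Ioo (0:ℝ) 1) ∧
        (∀ a : Fin (j + 1), z (Fin.castAdd (MZV.weight w) a) ∈ Set.Ioo (0:ℝ) 1) ∧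
        (∀ a b : Fin (j + 1), a < b → z (Fin.castAdd (MZV.weight w) a) < z (Fin.castAdd (MZV.weight w) b))} →
      (F (fun t => z (Fin.natAdd (j + 1) t)) -
        z (Fin.castAdd (MZV.weight w) (Fin.last j)) *
          F (σ (z (Fin.castAdd (MZV.weight w) (Fin.last j))) (fun t => z (Fin.natAdd (j + 1) t)))) *
        ∏ a : Fin (j + 1), 1 / (1 - z (Fin.castAdd (MZV.weight w) a)) =
      ∑ i : Fin (w.length - m), ((Rr i).integrand z + (Rh i).integrand z) := by
    intro z hz
    obtain ⟨hx, hv, hvm⟩ := hz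
    -- the block `y = (v_j, x)`
    have hy : ∀ s : Fin (MZV.weight w + 1),
        (fun s : Fin (MZV.weight w + 1) => z (Fin.cast hjn (Fin.natAdd j s))) s ∈ Set.Ioo (0:ℝ) 1 := by
      refine Fin.cases ?_ (fun t => ?_)
      · simp only [h0]; exact hv (Fin.last j)
      · simp only [hs]; exact hx t
    have htail : (fun t : Fin (MZV.weight w) => z (Fin.natAdd (j + 1) t)) =
        Fin.tail (fun s : Fin (MZV.weight w + 1) => z (Fin.cast hjn (Fin.natAdd j s))) := by
      funext t; simp only [Fin.tail, hs]
    have hzero : z (Fin.castAdd (MZV.weight w) (Fin.last j)) = z (Fin.cast hjn (Fin.natAdd j 0)) := by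
      rw [h0]
    have h1v : (1:ℝ) - z (Fin.cast hjn (Fin.natAdd j 0)) ≠ 0 := by
      rw [h0]; exact (sub_pos.mpr (hv (Fin.last j)).2).ne'
    have key := stuffle_integrand_eq_from w hw hne hm F σ hF hσ
      (fun s : Fin (MZV.weight w + 1) => z (Fin.cast hjn (Fin.natAdd j s))) hy
    rw [Finset.sum_Ico_eq_sum_range, ← Fin.sum_univ_eq_sum_range] at key
    rw [Finset.sum_congr rfl fun i _ => by rw [hRr_int i z (by rw [hRr_dom]; exact ⟨hx, hv, hvm⟩),
      hRh_int i z (by rw [hRh_dom]; exact ⟨hx, hv, hvm⟩)]]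
    rw [Fin.prod_univ_castSucc, hzero, htail, ← mul_assoc, mul_one_div, mul_div_right_comm, key,
      Finset.sum_mul]
    exact Finset.sum_congr rfl fun i _ => by rw [add_mul]
  -- semialgebraicity and integrability of the split sum on the END domain
  have hdom : Literature.ModelTheory.ExponentialFields.IsSemialgebraic ℚ
      {z : Fin ((j + 1) + MZV.weight w) → ℝ |
        (∀ i : Fin (MZV.weight w), z (Fin.natAdd (j + 1) i) ∈ Set.Ioo (0:ℝ) 1) ∧
        (∀ a : Fin (j + 1), z (Fin.castAdd (MZV.weight w) a) ∈ Set.Ioo (0:ℝ) 1) ∧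
        (∀ a b : Fin (j + 1), a < b → z (Fin.castAdd (MZV.weight w) a) < z (Fin.castAdd (MZV.weight w) b))} :=
    isSemialgebraic_endDomain (j + 1) (MZV.weight w)
  have hdm := Literature.ModelTheory.ExponentialFields.IsSemialgebraic.measurableSet_holds hdom
  have hsa : IsSemialgebraicFunOn ℚ {z : Fin ((j + 1) + MZV.weight w) → ℝ |
        (∀ i : Fin (MZV.weight w), z (Fin.natAdd (j + 1) i) ∈ Set.Ioo (0:ℝ) 1) ∧
        (∀ a : Fin (j + 1), z (Fin.castAdd (MZV.weight w) a) ∈ Set.Ioo (0:ℝ) 1) ∧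
        (∀ a b : Fin (j + 1), a < b → z (Fin.castAdd (MZV.weight w) a) < z (Fin.castAdd (MZV.weight w) b))}
      (fun z => (F (fun t => z (Fin.natAdd (j + 1) t)) -
        z (Fin.castAdd (MZV.weight w) (Fin.last j)) *
          F (σ (z (Fin.castAdd (MZV.weight w) (Fin.last j))) (fun t => z (Fin.natAdd (j + 1) t)))) *
        ∏ a : Fin (j + 1), 1 / (1 - z (Fin.castAdd (MZV.weight w) a))) := by
    refine (KZ.isSemialgebraicFunOn_finset_sum Finset.univ hdom
      (f := fun i z => (Rr i).integrand z + (Rh i).integrand z) fun i _ => ?_).congr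
      fun z hz => (hsplit z hz).symm
    exact IsSemialgebraicFunOn.add_holds (hRr_dom i ▸ (Rr i).isSemialgebraicFunOn_integrand)
      (hRh_dom i ▸ (Rh i).isSemialgebraicFunOn_integrand)
  have hint : IntegrableOn (fun z => (F (fun t => z (Fin.natAdd (j + 1) t)) -
        z (Fin.castAdd (MZV.weight w) (Fin.last j)) *
          F (σ (z (Fin.castAdd (MZV.weight w) (Fin.last j))) (fun t => z (Fin.natAdd (j + 1) t)))) *
        ∏ a : Fin (j + 1), 1 / (1 - z (Fin.castAdd (MZV.weight w) a)))
      {z : Fin ((j + 1) + MZV.weight w) → ℝ |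
        (∀ i : Fin (MZV.weight w), z (Fin.natAdd (j + 1) i) ∈ Set.Ioo (0:ℝ) 1) ∧
        (∀ a : Fin (j + 1), z (Fin.castAdd (MZV.weight w) a) ∈ Set.Ioo (0:ℝ) 1) ∧
        (∀ a b : Fin (j + 1), a < b → z (Fin.castAdd (MZV.weight w) a) < z (Fin.castAdd (MZV.weight w) b))} := by
    refine IntegrableOn.congr_fun (f := fun z => ∑ i : Fin (w.length - m),
      ((Rr i).integrand z + (Rh i).integrand z)) ?_ (fun z hz => (hsplit z hz).symm) hdm
    exact integrable_finsetSum _ fun i _ =>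
      (hRr_dom i ▸ (Rr i).integrableOn).add (hRh_dom i ▸ (Rh i).integrableOn)
  refine ⟨⟨⟨_, _, hdom, hsa, hint⟩, rfl, fun z _ => rfl⟩, ?_⟩
  -- the relation
  intro r hrd hri
  obtain ⟨Z, hZd, hZi⟩ := KZ.exists_zeroRep (n := (j + 1) + MZV.weight w) hdom
  have hZ : KZ.of Z ∈ KZ.relations :=
    KZ.of_mem_relations_of_eqOn_zero Z (by rw [hZi]; exact fun _ _ => rfl)
  have hmain : KZ.of r - KZ.of Z - ∑ i, KZ.of (Fin.append Rr Rh i) ∈ KZ.relations := by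
    refine KZ.of_sub_of_sub_sum_mem_relations ((w.length - m) + (w.length - m)) r Z (Fin.append Rr Rh)
      (hZd.trans hrd.symm) (fun i => ?_) fun z hz => ?_
    · refine Fin.addCases (fun i => ?_) (fun i => ?_) i
      · rw [Fin.append_left]; exact (hRr_dom i).trans hrd.symm
      · rw [Fin.append_right]; exact (hRh_dom i).trans hrd.symm
    · rw [hrd] at hz
      rw [hri (hrd ▸ hz)]
      beta_reduce
      rw [hZi, Pi.zero_apply, zero_add, Fin.sum_univ_add]
      simp only [Fin.append_left, Fin.append_right]
      rw [hsplit z hz, ← Finset.sum_add_distrib]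
  have hsum : ∑ i, KZ.of (Fin.append Rr Rh i) = ∑ i, KZ.of (Rr i) + ∑ i, KZ.of (Rh i) := by
    rw [Fin.sum_univ_add]; simp only [Fin.append_left, Fin.append_right]
  have hCr : ∀ i : Fin (w.length - m),
      C (w.take (m + i) ++ [w.getD (m + i) 0 + 1] ++ w.drop (m + i + 1)) (m + i) - KZ.of (Rr i) ∈
        KZ.relations := by
    intro i; rw [hρC _ (hadm_r i) (hne_r i) (m + i)]; exact KZ.of_sub_of_reindex_mem_relations _ _
  have hCh : ∀ i : Fin (w.length - m),
      C (w.take (m + i + 1) ++ [1] ++ w.drop (m + i + 1)) (m + i + 1) - KZ.of (Rh i) ∈ KZ.relations := by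
    intro i; rw [hρC _ (hadm_h i) (hne_h i) (m + i + 1)]; exact KZ.of_sub_of_reindex_mem_relations _ _
  rw [Finset.sum_Ico_eq_sum_range, ← Fin.sum_univ_eq_sum_range, Finset.sum_add_distrib]
  have key : KZ.of r - (∑ i : Fin (w.length - m),
      C (w.take (m + i) ++ [w.getD (m + i) 0 + 1] ++ w.drop (m + i + 1)) (m + i) +
      ∑ i : Fin (w.length - m), C (w.take (m + i + 1) ++ [1] ++ w.drop (m + i + 1)) (m + i + 1)) =
      (KZ.of r - KZ.of Z - ∑ i, KZ.of (Fin.append Rr Rh i)) + KZ.of Z -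
        (∑ i : Fin (w.length - m),
          (C (w.take (m + i) ++ [w.getD (m + i) 0 + 1] ++ w.drop (m + i + 1)) (m + i) - KZ.of (Rr i))) -
        ∑ i : Fin (w.length - m),
          (C (w.take (m + i + 1) ++ [1] ++ w.drop (m + i + 1)) (m + i + 1) - KZ.of (Rh i)) := by
    rw [hsum, Finset.sum_sub_distrib, Finset.sum_sub_distrib]; abel
  rw [key]
  exact KZ.relations.sub_mem (KZ.relations.sub_mem (KZ.relations.add_mem hmain hZ)
    (KZ.relations.sum_mem fun i _ => hCr i)) (KZ.relations.sum_mem fun i _ => hCh i)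

end Summit.KontsevichZagierPeriods.FurushoPentagon.DoubleShuffleInKZ
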